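/-
Copyright: lit-balaban Phase-2 proof seat p08 (gen 8).  Statement-level skeleton of a published paper; no proof claims beyond what
the kernel checks below.
-/
import Literature.MathematicalPhysics.QuantumFieldTheory.BalabanImbrieJaffe1984to88.BIJ85CurlyDkHolderSum

/-!
# `BalabanImbrieJaffe1984to88.BIJ85CurlyDkHolderTorus` — T. Bałaban, J. Imbrie, A. Jaffe, *Renormalization of the Higgs model: minimizers,
propagators and the stability of mean field theory*, Commun. Math. Phys. **97** (1985) 299–329 [BalabanImbrieJaffe1985]: Sect. 7.2,
p. 326, **the HÖLDER member of «𝒟_k has the same properties as G_k in [6I], Proposition 1.2» ON THE TORI FOR THE `𝒟_k` OF RECORD,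
GIVEN ONLY [6I] PROPOSITION 1.2** (`B5.Prop12Printed`), file 3 of 3 (assembly): the three members of (7.2.2) extracted from r15's typed
`KernelData.Ineq722` for p09's kernel family, the (7.2.3) input hypothesis-free by p09

statement-level skeleton of published theorems with citation tags; proofs where landed; nothing here is a claim about the Yang–Mills mass gap

PDF held: `paper:balaban1985-cmp97-bij-higgs-minimizers` (journal page = PDF page + 298), p. 312 [PDF 14], pp. 325–326 [PDF 27–28]
(text layer `~/.lit/texts/paper-balaban1985-cmp97-bij-higgs-minimizers/p0014.txt`, `p0027.txt`, `p0028.txt`, re-read this session);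
[6I] = [Balaban1984PropagatorsI] Prop. 1.2 (tree name `Balaban1983to89.B5.Prop12Printed`).

CITATION HEADER (lean-in-tree rule).  Part of the lit-balaban TYPED SKELETON (HOME `run/shared/lean/pub/lit-balaban/`), Phase-2 proof
seat p08 (gen 8), unit `lit-balaban-p08`; WHAT IS REPRODUCED = the located sentence of SKELETON row **C1.Eq7.2.4** (owner r15, referee
ref-5), HÖLDER MEMBER, for the `𝒟_k` of record of rows **C1.Eq4.4.4** / **C2.Eq2.12**, kind «model instance».  TAKING line HOME/STATUS.md
2026-08-21T19:42:18Z.  Decls used BY NAME (nothing restated): file 2's `BIJ85CurlyDkHolderSum.abs_dkKernel_secondDiff_le`; p09's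
`ineq722_deltaA_of_prop12Printed`, `torusKernelData`/`torusRep`/`gradH_eq`/`torusRep_dS`/`levStd`, `ineq723_CE_lt` (via
`BIJ88Decay216Prop12.ineq723_CE_torus`); p08 g7's `torusKernelData_H`/`_distEU`/`_distEta`/`_gradH`/`_gradH_nonneg`/`_gradHDiff_nonneg`;
r15's typed `BIJ85Sect7Statements.KernelData.Ineq722`; the tree's `supDist_runSite_le`.

THE PRINTED TEXT (p. 326 [PDF 28], verbatim): *"The operators 𝒟_k have the same properties as the operators G_k in [6I], Proposition 1.2,
with exponential decay but singularities on the diagonal. These properties follow from (4.4.4) and the above estimates on H_k, C^{(k)}."*;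
(7.2.2) p. 325: *"there exists δ > 0 and for 0 ≦ α < 1 a constant M = M(α) < ∞ such that for |x − x′| ≦ 1, |H_{k,μν}(x,y)| +
|∇H_{k,μν}(x,y)| + |x − x′|^{−α}|∇H_{k,μν}(x,y) − ∇H_{k,μν}(x′,y)| ≦ Me^{−δ|x−y|}. (7.2.2)"*; (7.2.3) p. 325 *"|C^{(k)}_{μν}(x,y)| ≦
Me^{−δ|x−y|}"*; (4.4.4) p. 312 *"𝒟_k = Σ_{j=0}^{k−1} H_jC^{(j)}H_j*"*.

THE TORUS DATA (all in the tree; as in the companion files): tori `Balaban1983to89.Setup`/`Params` (`d ≥ 2`, standing range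
`k ≤ m + K`, `η_k = L^{−k}`); fine sites `x, x′ : Site P 0`, `η`-bonds `⟨x, μ⟩ : PBond P 0`; `ℓ^∞` distances `|·|_∞/L^k` in the unit of
`T₁^{(k)}` (`supDist`); the kernel `𝒟_k(b, b″) := (𝒟_ke_{b″})(b)` of p11's `DkE P η_k^d L^k k` and its `η`-difference
`Δ_λ𝒟_k(⟨x, μ⟩, b″) := 𝒟_k(⟨x+e_λ, μ⟩, b″) − 𝒟_k(⟨x, μ⟩, b″)`; the scale-`j` Landau kernels `H_{j,μν}(x; y)` of p09's
`torusRep P j (deltaAData …)` and the three members of (7.2.2) in the shape of p09's carrier `torusKernelData` (`gradH`, `gradHDiff` =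
sup over `λ` of `L^j`·forward differences; `distEta = |x − x′|_∞/L^j`); the unit-lattice matrices of p11's `CE P η_j^d L^j j`.

WHAT IS PROVED (0 `sorry`, standard axioms; theorems only — proof lane; every `d ≥ 2`):
* **`torusKernelData_gradHDiff`** (unfolding of the Hölder member of p09's carrier); **`exists_holderBounds_of_ineq722`**: from
  `KernelData.Ineq722` for p09's family and `0 ≤ α < 1`, ONE rate `δ` and constants `M, M_α ≥ 0` with `|H| + |∇H| ≤ Me^{−δ|x−y|}` and, for
  `x ≠ x′`, `|x − x′|_∞/L^j ≤ 1`: `(|x − x′|_∞/L^j)^{−α}|∇H(x, y) − ∇H(x′, y)| ≤ M_αe^{−δ|x−y|}`.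
* **`holderDk_torus_of_ineq722_lt`** and **`holderDk_torus_prop12`**: for every `0 ≤ α < 1`, `∃ R₀ c₂ δ′, 0 < δ′ ∧ 0 ≤ c₂ ∧ ∀ k ≤ m + K,
  ∀ x ≠ x′` with `|x − x′|_∞/L^k ≤ 1`, `∀ μ λ b″` with `|x − b″₋|_∞/L^k ≥ R₀`: `L^k·|Δ_λ𝒟_k(⟨x, μ⟩, b″) − Δ_λ𝒟_k(⟨x′, μ⟩, b″)| ≤
  c₂(|x − x′|_∞/L^k)^α e^{−δ′|x − b″₋|_∞/L^k}` GIVEN ONLY `B5.Prop12Printed` — with `BIJ85CurlyDkDecayTorus.decayDk_torus_prop12` (sup) and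
  `BIJ85CurlyDkGradTorus.gradDk_torus_prop12` (gradient), all three (7.2.2)-type members of [6I] Prop. 1.2 for the `𝒟_k` of record.
HONEST SCOPE.  (i) [6I] Proposition 1.2 enters BY NAME for the torus settings `settingOf (torusRep P (levStd P i) …) i`; its constants,
hence `(R₀, c₂, δ′)` (which depend on `α` through `M_α`), are existential PER TORUS `P`, uniform in `k ≤ m + K`.  (ii) «singularities on the
diagonal»: no short-distance statement in any of the three files (only the scaling identity `BIJ85CurlyDkDecayTorus.dkKernel_eta_eq`).
(iii) `U = 1`, real abelian fields, torus, standing range.  (iv) No `def`, no new named fact, nothing restated; NOT summit progress.  Unit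
`lit-balaban-p08` (literature-prover-lit-balaban-p08-g8-0), 2026-08-21.
-/

open scoped BigOperators RealInnerProductSpace

namespace Literature.MathematicalPhysics.QuantumFieldTheory.BalabanImbrieJaffe1984to88.BIJ85CurlyDkHolderTorus

open Balaban1983to89 hiding Site Plaq
open Balaban1983to89.LatticeFieldCalculus
open Balaban1983to89.B3TorusRadialSums (supDist_eq_zero_iff)
open BIJ88SigmaKernelDkTorus BIJ88Ineq217Ineq722Torus BIJ88Decay216Torus
open BIJ85AxialPropagator411 BIJ85Prop521Torus BIJ85Prop522Torus BIJ85Sigma422Eta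
open BIJ85Sect7Statements BIJ85Ineq722Torus BIJ85Eq721MinimizerKernel
open BIJ85Ineq722DeltaA (deltaAData ineq722_deltaA_of_prop12Printed)
open BIJ85Ineq722ProofPart2 (settingOf)
open BIJ88Decay216Native (abs_inner_cE_ambient_le)
open BIJ88Decay216Prop12 (ineq723_CE_torus)
open BIJ85CurlyDkHolderSum (abs_dkKernel_secondDiff_le)
-- inside this namespace the bare `Site`/`Plaq` are the `ℤ^d` carriers of the QFT root; the torus ones are renamed:
open Balaban1983to89 renaming Site → TSite, Plaq → TPlaq

noncomputable section

variable {P : Params}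

/-! ## §4  Assembly: the Hölder member of the p. 326 sentence on the tori given only [6I] Proposition 1.2 -/

/-- `0 < L^n`. [folklore] -/
private theorem cast_pow_L_pos' (n : ℕ) : (0 : ℝ) < (P.L : ℝ) ^ n := pow_pos P.cast_L_pos n


/-- the Hölder member `|∇H(x, y) − ∇H(x′, y)|` of p09's torus carrier unfolded: the sup over `λ` of the difference of the forward
difference quotients at `x` and at `x′`. [cite: BalabanImbrieJaffe1985, (7.2.2) p.325] -/
theorem torusKernelData_gradHDiff {j : ℕ} (hj : j ≤ P.m + P.K) (a : ℝ) (BondU : Type) (distEB : TSite P 0 → BondU → ℝ)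
    (Cker : Fin P.d → Fin P.d → TSite P j → TSite P j → ℝ) (Dker : TSite P 0 → BondU → ℝ) (μ ν : Fin P.d) (x x' : TSite P 0)
    (y : TSite P j) :
    (torusKernelData P j (deltaAData hj a) BondU distEB Cker Dker).gradHDiff μ ν x x' y =
      ‖fun lam : Fin P.d => (P.L : ℝ) ^ j * ((torusRep P j (deltaAData hj a)).H (x.shift lam, μ) (y, ν) -
          (torusRep P j (deltaAData hj a)).H (x, μ) (y, ν)) -
        (P.L : ℝ) ^ j * ((torusRep P j (deltaAData hj a)).H (x'.shift lam, μ) (y, ν) -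
          (torusRep P j (deltaAData hj a)).H (x', μ) (y, ν))‖ := by
  show ‖fun lam : Fin P.d => (torusRep P j (deltaAData hj a)).gradH (x, lam, μ) (y, ν) -
      (torusRep P j (deltaAData hj a)).gradH (x', lam, μ) (y, ν)‖ = _
  simp only [gradH_eq]

/-- `x + e_μ ≠ x` on every torus of the series (`1 ≠ 0` in `ZMod (2L^{m+K−j})`; p08 g7 private lemma, re-proved). [folklore] -/
private theorem shift_ne_self' {j : ℕ} (x : TSite P j) (μ : Fin P.d) : x.shift μ ≠ x := by
  intro h
  have h1 := congrFun h μ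
  simp only [Balaban1983to89.Site.shift, Function.update_self] at h1
  exact one_ne_zero (add_eq_left.1 h1)

/-- `|x − (x + e_μ)|_∞ ≤ 1` (p08 g7 private lemma, re-proved). [folklore] -/
private theorem supDist_shift_le {j : ℕ} (x : TSite P j) (μ : Fin P.d) : supDist x (x.shift μ) ≤ 1 := by
  have h := supDist_runSite_le x μ 1
  have h2 : runSite x μ 1 = x.shift μ := by
    show Function.update x μ (x μ + ((1 : ℕ) : ZMod _)) = Function.update x μ (x μ + 1)
    rw [Nat.cast_one]
  rwa [h2] at h

/-- **THE THREE MEMBERS OF (7.2.2) EXTRACTED FROM r15's TYPED `Ineq722`** for p09's torus kernel family at a Hölder exponent `0 ≤ α < 1`: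
one rate `δ > 0` and constants `M, M_α ≥ 0` with `|H| + |∇H| ≤ Me^{−δ|x−y|}` (the `α = 0` instance at the admissible pair `(x, x + ηe_μ)`)
and, for `x ≠ x′`, `|x − x′| ≤ 1` (scale-`j` units): `|x − x′|^{−α}|∇H(x, y) − ∇H(x′, y)| ≤ M_αe^{−δ|x−y|}`. [cite: BalabanImbrieJaffe1985, (7.2.2) p.325] -/
theorem exists_holderBounds_of_ineq722 {lev : ℕ → ℕ} (hlev : ∀ i, lev i ≤ P.m + P.K) {a : ℝ} {BondU : ℕ → Type}
    {distEB : (i : ℕ) → TSite P 0 → BondU i → ℝ} {Cker : (i : ℕ) → Fin P.d → Fin P.d → TSite P (lev i) → TSite P (lev i) → ℝ}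
    {Dker : (i : ℕ) → TSite P 0 → BondU i → ℝ}
    (h722 : KernelData.Ineq722
      (fun i => torusKernelData P (lev i) (deltaAData (hlev i) a) (BondU i) (distEB i) (Cker i) (Dker i)))
    {α : ℝ} (hα0 : 0 ≤ α) (hα1 : α < 1) :
    ∃ δ M Mα : ℝ, 0 < δ ∧ 0 ≤ M ∧ 0 ≤ Mα ∧
      (∀ (i : ℕ) (μ ν : Fin P.d) (x : TSite P 0) (y : TSite P (lev i)),
        |(torusRep P (lev i) (deltaAData (hlev i) a)).H (x, μ) (y, ν)| +
            (torusKernelData P (lev i) (deltaAData (hlev i) a) (BondU i) (distEB i) (Cker i) (Dker i)).gradH μ ν x y ≤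
          M * Real.exp (-(δ * distEU P (lev i) x y))) ∧
      (∀ (i : ℕ) (μ ν : Fin P.d) (x x' : TSite P 0) (y : TSite P (lev i)), x ≠ x' →
        (supDist x x' : ℝ) / (P.L : ℝ) ^ (lev i) ≤ 1 →
        ((supDist x x' : ℝ) / (P.L : ℝ) ^ (lev i)) ^ (-α) *
            (torusKernelData P (lev i) (deltaAData (hlev i) a) (BondU i) (distEB i) (Cker i) (Dker i)).gradHDiff μ ν x x' y ≤
          Mα * Real.exp (-(δ * distEU P (lev i) x y))) := by
  obtain ⟨δ, hδ, hαf⟩ := h722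
  obtain ⟨M, hM⟩ := hαf 0 le_rfl zero_lt_one
  obtain ⟨Mα, hMα⟩ := hαf α hα0 hα1
  have hL1 : (1 : ℝ) ≤ (P.L : ℝ) := by exact_mod_cast P.L_pos
  have hadm : ∀ (i : ℕ) (x : TSite P 0) (μ : Fin P.d), (supDist x (x.shift μ) : ℝ) / (P.L : ℝ) ^ (lev i) ≤ 1 := by
    intro i x μ
    rw [div_le_one (cast_pow_L_pos' _)]
    have h1 : (supDist x (x.shift μ) : ℝ) ≤ 1 := by exact_mod_cast supDist_shift_le x μ
    exact h1.trans (one_le_pow₀ hL1)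
  have keyα : ∀ (i : ℕ) (μ ν : Fin P.d) (x x' : TSite P 0) (y : TSite P (lev i)), x ≠ x' →
      (supDist x x' : ℝ) / (P.L : ℝ) ^ (lev i) ≤ 1 →
      ((supDist x x' : ℝ) / (P.L : ℝ) ^ (lev i)) ^ (-α) *
          (torusKernelData P (lev i) (deltaAData (hlev i) a) (BondU i) (distEB i) (Cker i) (Dker i)).gradHDiff μ ν x x' y ≤
        Mα * Real.exp (-(δ * distEU P (lev i) x y)) := by
    intro i μ ν x x' y hne hle
    have h := hMα i μ ν x x' y hne (by rw [torusKernelData_distEta, torusRep_dS]; exact hle)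
    rw [torusKernelData_H, torusKernelData_distEU, torusKernelData_distEta, torusRep_dS] at h
    exact (le_add_of_nonneg_left (add_nonneg (abs_nonneg _) torusKernelData_gradH_nonneg)).trans h
  have key : ∀ (i : ℕ) (μ ν : Fin P.d) (x : TSite P 0) (y : TSite P (lev i)),
      |(torusRep P (lev i) (deltaAData (hlev i) a)).H (x, μ) (y, ν)| +
          (torusKernelData P (lev i) (deltaAData (hlev i) a) (BondU i) (distEB i) (Cker i) (Dker i)).gradH μ ν x y ≤
        M * Real.exp (-(δ * distEU P (lev i) x y)) := by
    intro i μ ν x y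
    have h := hM i μ ν x (x.shift μ) y (shift_ne_self' x μ).symm
      (by rw [torusKernelData_distEta, torusRep_dS]; exact hadm i x μ)
    rw [neg_zero, Real.rpow_zero, one_mul, torusKernelData_H, torusKernelData_distEU] at h
    exact (le_add_of_nonneg_right torusKernelData_gradHDiff_nonneg).trans h
  have hM0 : 0 ≤ M :=
    (mul_nonneg_iff_of_pos_right (Real.exp_pos _)).1
      (le_trans (add_nonneg (abs_nonneg _) torusKernelData_gradH_nonneg) (key 0 ⟨0, P.hd⟩ ⟨0, P.hd⟩ default default))
  have hMα0 : 0 ≤ Mα := by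
    have h := keyα 0 ⟨0, P.hd⟩ ⟨0, P.hd⟩ default _ default (shift_ne_self' default ⟨0, P.hd⟩).symm (hadm 0 default ⟨0, P.hd⟩)
    exact (mul_nonneg_iff_of_pos_right (Real.exp_pos _)).1
      ((mul_nonneg (Real.rpow_nonneg (div_nonneg (Nat.cast_nonneg _) (cast_pow_L_pos' _).le) _)
        torusKernelData_gradHDiff_nonneg).trans h)
  exact ⟨δ, M, Mα, hδ, hM0, hMα0, key, keyα⟩

/-- **THE HÖLDER QUOTIENT OF `∇𝒟_k` DECAYS EXPONENTIALLY ON THE TORI, FROM THE TYPED (7.2.2) AND THE NATIVE (7.2.3)**, constants UNIFORM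
IN `k`, any `0 ≤ α < 1`: `∃ R₀ c₂ δ′, 0 < δ′ ∧ 0 ≤ c₂ ∧ ∀ k ≤ m + K, ∀ x ≠ x′` with `|x − x′|_∞/L^k ≤ 1`, `∀ μ λ b″` with
`|x − b″₋|_∞/L^k ≥ R₀`: `L^k·|Δ_λ𝒟_k(⟨x, μ⟩, b″) − Δ_λ𝒟_k(⟨x′, μ⟩, b″)| ≤ c₂(|x − x′|_∞/L^k)^α e^{−δ′|x − b″₋|_∞/L^k}` for p11's
`𝒟_k = DkE P η_k^d L^k k`. [cite: BalabanImbrieJaffe1985, (4.4.4) p.312] -/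
theorem holderDk_torus_of_ineq722_lt (hd : 2 ≤ P.d) {lev : ℕ → ℕ} (hlev : ∀ i, lev i ≤ P.m + P.K)
    (hcov : ∀ j ≤ P.m + P.K, ∃ i, lev i = j) {a : ℝ} (ha : 0 < a) {BondU : ℕ → Type}
    {distEB : (i : ℕ) → TSite P 0 → BondU i → ℝ} {Cker : (i : ℕ) → Fin P.d → Fin P.d → TSite P (lev i) → TSite P (lev i) → ℝ}
    {Dker : (i : ℕ) → TSite P 0 → BondU i → ℝ}
    (h722 : KernelData.Ineq722
      (fun i => torusKernelData P (lev i) (deltaAData (hlev i) a) (BondU i) (distEB i) (Cker i) (Dker i)))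
    {δC MC : ℝ} (hδC : 0 < δC) (hMC : 0 ≤ MC)
    (hC : ∀ k ≤ P.m + P.K, ∀ j < k, ∀ b₁ b₂ : PBond P j, |⟪toEj P j (Pi.single b₁ 1),
      CE P ((P.eta j) ^ P.d) ((P.L : ℝ) ^ j) j (toEj P j (Pi.single b₂ 1))⟫| ≤ MC * Real.exp (-(δC * (supDist b₁.src b₂.src : ℝ))))
    {α : ℝ} (hα0 : 0 ≤ α) (hα1 : α < 1) :
    ∃ R₀ c₂ δ' : ℝ, 0 < δ' ∧ 0 ≤ c₂ ∧ ∀ (k : ℕ) (hk : k ≤ P.m + P.K) (x x' : TSite P 0) (μ lam : Fin P.d) (b'' : PBond P 0),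
        x ≠ x' → (supDist x x' : ℝ) / (P.L : ℝ) ^ k ≤ 1 → R₀ ≤ (supDist x b''.src : ℝ) / (P.L : ℝ) ^ k →
        (P.L : ℝ) ^ k * |(DkE P ((P.eta k) ^ P.d) ((P.L : ℝ) ^ k) k (toE P (Pi.single b'' 1)) ⟨x.shift lam, μ⟩ -
              DkE P ((P.eta k) ^ P.d) ((P.L : ℝ) ^ k) k (toE P (Pi.single b'' 1)) ⟨x, μ⟩) -
            (DkE P ((P.eta k) ^ P.d) ((P.L : ℝ) ^ k) k (toE P (Pi.single b'' 1)) ⟨x'.shift lam, μ⟩ -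
              DkE P ((P.eta k) ^ P.d) ((P.L : ℝ) ^ k) k (toE P (Pi.single b'' 1)) ⟨x', μ⟩)| ≤
          c₂ * ((supDist x x' : ℝ) / (P.L : ℝ) ^ k) ^ α * Real.exp (-δ' * ((supDist x b''.src : ℝ) / (P.L : ℝ) ^ k)) := by
  obtain ⟨δ, M, Mα, hδ, hM, hMα, key, keyα⟩ := exists_holderBounds_of_ineq722 hlev h722 hα0 hα1
  refine ⟨3, 2 * ((M + Mα) * M * MC) * ((P.d : ℝ) ^ 2 * (Real.exp (min δ δC / 2 / 2) * ((2 * (1 + P.d / (min δ δC / 2))) ^ P.d) ^ 2)) *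
      (((P.d + 1).factorial : ℝ) / (min δ δC / 2) ^ (P.d + 1)) * Real.exp (min δ δC / 2 / 2),
    min δ δC / 2 / 2, by positivity, by positivity, fun k hk x x' μ lam b'' hne hr hfar => ?_⟩
  have hH : ∀ (j : ℕ) (hj : j ≤ P.m + P.K), j < k → ∀ (μ ν : Fin P.d) (x : TSite P 0) (y : TSite P j),
      |(torusRep P j (deltaAData hj a)).H (x, μ) (y, ν)| ≤ M * Real.exp (-(δ * distEU P j x y)) := by
    intro j hj _ μ ν x y
    obtain ⟨i, hi⟩ := hcov j hj
    subst hi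
    exact (le_add_of_nonneg_right torusKernelData_gradH_nonneg).trans (key i μ ν x y)
  have hB : ∀ (j : ℕ) (hj : j ≤ P.m + P.K), j < k → ∀ (μ ν : Fin P.d) (x : TSite P 0) (y : TSite P j),
      ‖fun lam : Fin P.d => (P.L : ℝ) ^ j *
          ((torusRep P j (deltaAData hj a)).H (x.shift lam, μ) (y, ν) - (torusRep P j (deltaAData hj a)).H (x, μ) (y, ν))‖ ≤
        M * Real.exp (-(δ * distEU P j x y)) := by
    intro j hj _ μ ν x y
    obtain ⟨i, hi⟩ := hcov j hj
    subst hi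
    have h := key i μ ν x y
    rw [torusKernelData_gradH] at h
    exact (le_add_of_nonneg_left (abs_nonneg _)).trans h
  have hHol : ∀ (j : ℕ) (hj : j ≤ P.m + P.K), j < k → ∀ (μ ν : Fin P.d) (x x' : TSite P 0) (y : TSite P j), x ≠ x' →
      (supDist x x' : ℝ) / (P.L : ℝ) ^ j ≤ 1 →
      ((supDist x x' : ℝ) / (P.L : ℝ) ^ j) ^ (-α) *
          ‖fun lam : Fin P.d => (P.L : ℝ) ^ j * ((torusRep P j (deltaAData hj a)).H (x.shift lam, μ) (y, ν) -
              (torusRep P j (deltaAData hj a)).H (x, μ) (y, ν)) -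
            (P.L : ℝ) ^ j * ((torusRep P j (deltaAData hj a)).H (x'.shift lam, μ) (y, ν) -
              (torusRep P j (deltaAData hj a)).H (x', μ) (y, ν))‖ ≤
        Mα * Real.exp (-(δ * distEU P j x y)) := by
    intro j hj _ μ ν x x' y hne hle
    obtain ⟨i, hi⟩ := hcov j hj
    subst hi
    have h := keyα i μ ν x x' y hne hle
    rw [torusKernelData_gradHDiff] at h
    exact h
  have hLk : 0 < (P.L : ℝ) ^ k := cast_pow_L_pos' k
  have h := abs_dkKernel_secondDiff_le hd hk ha hδ hδC hM hMα hα0 hα1.le hMC hH hB hHol (fun j hjk => hC k hk j hjk)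
    hne hr μ lam hfar
  rw [neg_mul]
  calc _ ≤ (P.L : ℝ) ^ k * (((P.L : ℝ) ^ k)⁻¹ * ((supDist x x' : ℝ) / (P.L : ℝ) ^ k) ^ α *
          (2 * ((M + Mα) * M * MC) * ((P.d : ℝ) ^ 2 * (Real.exp (min δ δC / 2 / 2) * ((2 * (1 + P.d / (min δ δC / 2))) ^ P.d) ^ 2)) *
            (((P.d + 1).factorial : ℝ) / (min δ δC / 2) ^ (P.d + 1)) * Real.exp (min δ δC / 2 / 2)) *
          Real.exp (-(min δ δC / 2 / 2 * ((supDist x b''.src : ℝ) / (P.L : ℝ) ^ k)))) :=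
        mul_le_mul_of_nonneg_left h hLk.le
    _ = _ := by rw [mul_assoc, mul_assoc, mul_inv_cancel_left₀ hLk.ne']; ring

/-- **THE HÖLDER MEMBER OF THE p. 326 SENTENCE ON THE TORI GIVEN ONLY [6I] PROPOSITION 1.2 BY ITS TREE NAME** (`B5.Prop12Printed` for p09's
family of scales `levStd`), any exponent `0 ≤ α < 1`: *"The operators 𝒟_k have the same properties as the operators G_k in [6I],
Proposition 1.2 …"* — the Hölder quotient `|x − x′|^{−α}|∇𝒟_k(x, b″) − ∇𝒟_k(x′, b″)|` (`∇ = η⁻¹Δ` in the first argument, `|x − x′| ≤ 1`,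
distances in the unit `L^kη`) is at most `c₂e^{−δ′|x − b″₋|}` beyond `R₀`, with `k`-INDEPENDENT `(R₀, c₂, δ′)`; (7.2.2) (all three members) via
p09's `ineq722_deltaA_of_prop12Printed`, (7.2.3) HYPOTHESIS-FREE by p09's `ineq723_CE_lt`. [cite: BalabanImbrieJaffe1985, (4.4.4) p.312] -/
theorem holderDk_torus_prop12 (hd : 2 ≤ P.d) {a : ℝ} (ha : 0 < a)
    (h12 : B5.Prop12Printed (fun i => settingOf (torusRep P (levStd P i) (deltaAData (levStd_le i) a)) i))
    {α : ℝ} (hα0 : 0 ≤ α) (hα1 : α < 1) :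
    ∃ R₀ c₂ δ' : ℝ, 0 < δ' ∧ 0 ≤ c₂ ∧ ∀ (k : ℕ) (hk : k ≤ P.m + P.K) (x x' : TSite P 0) (μ lam : Fin P.d) (b'' : PBond P 0),
        x ≠ x' → (supDist x x' : ℝ) / (P.L : ℝ) ^ k ≤ 1 → R₀ ≤ (supDist x b''.src : ℝ) / (P.L : ℝ) ^ k →
        (P.L : ℝ) ^ k * |(DkE P ((P.eta k) ^ P.d) ((P.L : ℝ) ^ k) k (toE P (Pi.single b'' 1)) ⟨x.shift lam, μ⟩ -
              DkE P ((P.eta k) ^ P.d) ((P.L : ℝ) ^ k) k (toE P (Pi.single b'' 1)) ⟨x, μ⟩) -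
            (DkE P ((P.eta k) ^ P.d) ((P.L : ℝ) ^ k) k (toE P (Pi.single b'' 1)) ⟨x'.shift lam, μ⟩ -
              DkE P ((P.eta k) ^ P.d) ((P.L : ℝ) ^ k) k (toE P (Pi.single b'' 1)) ⟨x', μ⟩)| ≤
          c₂ * ((supDist x x' : ℝ) / (P.L : ℝ) ^ k) ^ α * Real.exp (-δ' * ((supDist x b''.src : ℝ) / (P.L : ℝ) ^ k)) := by
  obtain ⟨MC, δC, hMC, hδC, hC⟩ := ineq723_CE_torus (P := P) hd
  exact holderDk_torus_of_ineq722_lt hd levStd_le (fun j hj => ⟨j, min_eq_left hj⟩) ha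
    (ineq722_deltaA_of_prop12Printed (levStd P) levStd_le ha (fun _ => PUnit) (fun _ _ _ => 0) (fun _ _ _ _ _ => 0)
      (fun _ _ _ => 0) h12) hδC hMC.le hC hα0 hα1

end

end Literature.MathematicalPhysics.QuantumFieldTheory.BalabanImbrieJaffe1984to88.BIJ85CurlyDkHolderTorus
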